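import Summits.QuantumFields.BalabanUV.T4Continuum.Support.NE3EnergyRateWSupCurved
import Summits.QuantumFields.BalabanUV.T4Continuum.Support.NE3ClassSlicePoincare
import HarnessLib

/-!
# T⁴ programme, node NE3 — THE END OF THE LOCAL HALF WITH (P♮)_W GONE FROM ITS HYPOTHESES: T-E_w♯ over `sfClass` from endpoint charts,
# level data and FOUR k-FREE NUMERIC LINES (the K-road), the class-level slice Poincaré inequality being NE3-R2's theorem
# `NE3ClassSlicePoincare.classSlicePoincare_of_lines` over row K6's END

NE3 (node U1b), row NE3 OWNER `b2b-balaban-t4-ne3-p1` (gen 25) — the 30-line consumer announced in g24's WITHDRAW (journal l.22137) and g25's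
ONLINE: `NE3EnergyRateWSupCurved.ne3EnergyRateWSup_sfClass_of_classSlicePoincare` (owner g24, p238615) with its hypothesis `hP` DISCHARGED BY NAME by
`NE3ClassSlicePoincare.classSlicePoincare_of_lines` (row NE3-R2 OWNER g11, p241642 — K-g11-1 part 3∕3, over leaf-02-g6's K6c-2b
`NE3SlicePoincareCurved.slicePoincare_frameFreeBlockLandauW` p237604 and the K-road letters `NE3SlicePoincareBudgetLine{,Y}`).

WHAT.  `ne3EnergyRateWSup_sfClass_of_lines`: for `3 ≤ d`, `2 ≤ L`, `1 ≤ N`, the class-transport numerics of `rescale_bavg_mem_sfClass`, row Y9's multi-level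
smallness `hsmall`, the K-ROAD LINES `hK1`–`hK4` in `(θK, εc)` with `ε ≤ θK` (NE3-R2's `lines_d4_L2_c2`∕`_c3` discharge them at an explicit point), the
regime∕budget numerics with `CP := CPLine d L (card n) εc θK` (`hCP : 0 ≤ CP` displayed), and per level∕datum∕pair an ENDPOINT CHART with uniform
`(θ, κ, θ₀, q)` and level data (J1)(J2) (`hchart` — route Π: `NE3EndpointPackageOfDecomposedRep.hchartPackage_of_decomposedRep` ∘
`NE3DecomposedRepOfShapes.decomposedRep_of_shapes` supply it from two typed leaves + letters) ⟹ `NE3EnergyRateWSup d (sfClass d L N ε) L N b g C′ s dom`.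
So the local half of NE3 on the fixed torus no longer carries (ML_w)∕(P♮)_W in ANY form among its hypotheses.

HONEST FRAMING.  A composition of two landed theorems; the endpoint charts (route Π's leaves), (H∃) and the displayed numerics remain hypotheses;
T-E_w♯, NE3 NOT proved; spine PROVED 0∕9; finite T⁴ rung (B)+1 — NOT infinite volume, NOT mass gap, NOT `BetaPertH`, NOT Clay.  PLACEMENT:
`Summits/QuantumFields/BalabanUV/`.  HONEST DEPENDENCY: continuum YM on T⁴ ⇐ BetaPertH ∧ nine spine estimates (0/9 proved); BetaPertH ⇐ (D1) ∧ (D4) ∧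
CAP+tail; G-an2-4 gates asym, D1 and NE2/3/4.
-/

set_option autoImplicit false

open scoped BigOperators Matrix.Norms.L2Operator
open NormedSpace Finset

namespace Summit.QuantumFields.BalabanUV.T4Continuum.NE3EnergyRateWSupLines

open Set
open Literature.MathematicalPhysics.QuantumFieldTheory.Balaban1983to89
open B7Prop1Explicit B7Prop2Explicit
open T4AveragingDeficitWall hiding Site Plane Plaq Bond
open T4AveragingDeficitWallBoundary (IsPeriodicCfg periodBox)
open AveragingDeficitPeriodicCounting (IsPeriodicDir)
open AveragingDeficitChartCalculus (cavg)
open AveragingDeficitMultiLevelPrep (LevelSmall)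
open NE3CovariantLineSumsL2 (C2sq)
open NE3CovariantLineSumsL2Tower (rho)
open MinimalActionRate (sfClass Regular)
open MinimalActionSandwich (IsMinimiser)
open NE3HessForm (dAction)
open NE3EnergyWeightedShapes (energyNormW)
open NE3EnergyWeightedSupShape (NE3EnergyRateWSup)
open NE3FrameFreeSliceW (frameFreeBlockLandauW)
open NE3EndpointChart (EndpointChart)
open NE3EnergyRateWSupOfSlicePoincare (cLambda)
open NE3EnergyRateWSupCurved (ne3EnergyRateWSup_sfClass_of_classSlicePoincare)
open NE3SlicePoincareBudgetLine (ShLine SmallYLine CPLine)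
open NE3ClassSlicePoincare (classSlicePoincare_of_lines)

noncomputable section

variable {d : ℕ} {n : Type*} [Fintype n] [DecidableEq n]

/-- **T-E_w♯ OVER `sfClass` FROM ENDPOINT CHARTS AND THE K-ROAD LINES — (P♮)_W IS NO LONGER A HYPOTHESIS.**  See the module docstring. [folklore] -/
theorem ne3EnergyRateWSup_sfClass_of_lines [Nonempty n] (hd : 3 ≤ d) {L N : ℕ} [NeZero L] [NeZero N] (hL : 2 ≤ L)
    (hN : 1 ≤ N) {ε b g : ℝ} (hb : 0 ≤ b) (hbε : b < ε) (hg : 0 < g)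
    (hbs : 512 * (d + 1) * (d + 4) * (L : ℝ) ^ 2 * b ≤ 1) (hbε' : b + 226 * (8 * (d + 1) * (d + 4)) ^ 2 * b ^ 2 ≤ ε)
    (hsmall : ∀ j : ℕ, LevelSmall d L (j + 1) (ε / ((L : ℝ) ^ (j + 2)) ^ 2))
    {dom : Set (Site d → Fin d → (Matrix n n ℂ)ˣ)} {θK εc : ℝ} (hε : 0 < ε) (hεθ : ε ≤ θK) (hεc : 0 < εc)
    (hK1 : ShLine d L (Fintype.card n) εc θK ≤ 1 / 2) (hK2 : SmallYLine d L (Fintype.card n) εc θK ≤ 1 / 2)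
    (hK3 : 68 / 3 * (((d : ℝ) + 1) * ((d : ℝ) + 4)) * C2sq d L * θK ≤ rho d L / 2)
    (hK4 : 8 * d * (((d : ℝ) - 1) * θK) ^ 2
      + 2 * ((Fintype.card n : ℝ) * ((4 * (d : ℝ) ^ 2 + 272 * d * (((d : ℝ) + 1) * ((d : ℝ) + 4))) * θK) ^ 2) ≤ 1 / 2)
    {Λ θ κ θ₀ q : ℝ}
    (hCP : 0 ≤ (CPLine d L (Fintype.card n) εc θK)) (hreg₁ : (CPLine d L (Fintype.card n) εc θK) * (Real.sqrt Λ - 1) ^ 2 ≤ 1 / 4) (hθ₀ : 0 ≤ θ₀)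
    (hbudget : 2 * Λ * θ + Λ * θ ^ 2 + κ + 2 * q ≤ cLambda n (CPLine d L (Fintype.card n) εc θK) Λ / 2)
    (hchart : ∀ j : ℕ, ∀ V ∈ dom, ∀ UA UB : Site d → Fin d → (Matrix n n ℂ)ˣ,
      IsMinimiser d (sfClass d L N ε) L N (j + 1) V UA → IsMinimiser d (sfClass d L N ε) L N (j + 2) V UB →
        Regular d L N b g (j + 2) UB →
        ∃ (u : Site d → (Matrix n n ℂ)ˣ) (Γ Ψ Ψ' : ℝ → Site d → Fin d → Matrix n n ℂ) (Xref : Site d → Fin d → Matrix n n ℂ)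
          (α a : ℝ), 0 ≤ α ∧ 0 ≤ a ∧
          EndpointChart (sfClass d L N ε) L N (j + 1) V UA UB u Γ Ψ Ψ' Xref (frameFreeBlockLandauW L N (j + 1) (cavg L UB))
            (fun Y => energyNormW L (j + 1) (cavg L UB) Y (periodBox (N * L ^ (j + 1)))) θ κ θ₀ q a ∧
          (∀ t (x : Site d) (μ : Fin d), ‖Γ t x μ‖ ≤ α) ∧
          (1 + 24 * Real.sqrt d * (Real.exp α - 1) * (L : ℝ) ^ (j + 1)) ^ 2 + 48 * d * a * ((L : ℝ) ^ (j + 1)) ^ 2 ≤ Λ ∧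
          112 * (d : ℝ) * a * (CPLine d L (Fintype.card n) εc θK) * ((L : ℝ) ^ (j + 1)) ^ 2 ≤ 1 / (2 * (Fintype.card n : ℝ))) :
    NE3EnergyRateWSup d (sfClass d L N ε) L N b g
      ((1 + θ₀) * (4 / cLambda n (CPLine d L (Fintype.card n) εc θK) Λ)
        * (Real.sqrt ((L : ℝ) ^ (d - 2))
            + (Real.sqrt ((L : ℝ) ^ (d - 2)) * Real.sqrt (8 * Fintype.card (T4AveragingDeficitWall.Plane d))
                * (128 * (d * (L : ℝ) ^ 2))
              + 2 * (2048 * ((d : ℝ) + 4) ^ 2 * (L : ℝ) ^ 2 * Real.sqrt (d * (L : ℝ) ^ d))) * b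
            + b ^ 2 * (2 * (L : ℝ) ^ (d - 1) + 2 * (8 * d * (L : ℝ) ^ d)) * Real.sqrt (d / (g * (L : ℝ) ^ (d + 2)))))
      ((Real.sqrt Λ - 1) / (24 * Real.sqrt d)) dom :=
  ne3EnergyRateWSup_sfClass_of_classSlicePoincare (by omega) (by omega) hN hb hbε hg hbs hbε' hsmall hCP hreg₁ hθ₀ hbudget
    (classSlicePoincare_of_lines hd hL hN hε hεθ hεc hsmall hK1 hK2 hK3 hK4) hchart

end

end Summit.QuantumFields.BalabanUV.T4Continuum.NE3EnergyRateWSupLines
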